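import Summits.RiemannHypothesis.RiemannHypothesis.Theorems.IntegerScrewCensusDualPack

/-!
# Route `IntegerScrew` — kernel checker for the census DUAL certificates (5): the analytic layer (one term)

Per-term error bounds for the Taylor models of the dual checker.  A TERM has a true unit phasor `ζ` (at the cell centre),
a stored Gaussian integer `ζ̂ ≈ 2^104 ζ` (`‖ζ̂ − 2^104 ζ‖ ≤ 2^104 δ`), a true scaled frequency `ν'` (`= h·ν`) and a table
frequency `c` (`|c − ν'| ≤ Δ'`), and integer Taylor weights `W_k` with `|W_k − K₁ c^k/k!| ≤ 1` (`k ≤ D`).  Then for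
`σ ∈ [−1,1]` the model values `Re(ζ̂ Σ_k W_k (iσ)^k)`, `Re(ζ̂ Σ_k k W_k i^k σ^{k−1})`, `Re(ζ̂ Σ_k k(k−1) W_k i^k σ^{k−2})` are
within explicit slacks of `2^104 K₁ Re(ζ e^{iσν'})`, `2^104 K₁ Re(ζ iν' e^{iσν'})`, `2^104 K₁ Re(ζ (iν')² e^{iσν'})`
(`Complex.exp_bound'`), and the true term obeys the one-sided third-order step
`Re(ζ e^{i(s+u)ω}) ≥ … − |ωu|³/3`.  RH-free; nothing here bears on the truth of RH.
-/

set_option linter.dupNamespace false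
set_option autoImplicit false

namespace Summit.RiemannHypothesis.RiemannHypothesis.Theorems.IntegerScrew.Manifest.Fast

open Finset Complex

/-! ### Exponential facts -/

/-- `‖e^{ia} − e^{ib}‖ ≤ |a − b|` for real `a, b`. -/
theorem norm_expI_sub_expI (a b : ℝ) : ‖exp (I * a) - exp (I * b)‖ ≤ |a - b| := by
  have h : exp (I * a) - exp (I * b) = exp (I * b) * (exp (I * ((a - b : ℝ) : ℂ)) - 1) := by
    rw [mul_sub, mul_one, ← Complex.exp_add]
    push_cast
    ring_nf
  rw [h, norm_mul, Complex.norm_exp_I_mul_ofReal, one_mul]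
  have := Real.norm_exp_I_mul_ofReal_sub_one_le (x := a - b)
  simpa [Real.norm_eq_abs] using this

/-- The truncated exponential series `T_n(z) = Σ_{m<n} z^m/m!`. -/
noncomputable def texp (n : ℕ) (z : ℂ) : ℂ := ∑ m ∈ range n, z ^ m / (m.factorial : ℂ)

/-- `Complex.exp_bound'` for a purely imaginary argument `iθ` with `|θ| ≤ c ≤ (n+1)/2`:
`‖e^{iθ} − T_n(iθ)‖ ≤ 2 c^n/n!`. -/
theorem texp_err {n : ℕ} {θ c : ℝ} (hθ : |θ| ≤ c) (hc : c ≤ ((n : ℝ) + 1) / 2) :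
    ‖exp (I * θ) - texp n (I * θ)‖ ≤ 2 * c ^ n / n.factorial := by
  have hθc : ‖(I * θ : ℂ)‖ ≤ c := by simpa [norm_mul, Complex.norm_I, Real.norm_eq_abs] using hθ
  have h0 : 0 ≤ c := (abs_nonneg θ).trans hθ
  have hx : ‖(I * θ : ℂ)‖ / (n.succ : ℝ) ≤ 1 / 2 := by
    rw [div_le_iff₀ (by positivity)]
    push_cast
    linarith
  have h := Complex.exp_bound' hx
  unfold texp
  refine h.trans ?_
  rw [div_mul_eq_mul_div, mul_comm]
  gcongr

/-- `‖T_n(iθ)‖ ≤ 1 + (remainder)`. -/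
theorem norm_texp_le {n : ℕ} {θ c : ℝ} (hθ : |θ| ≤ c) (hc : c ≤ ((n : ℝ) + 1) / 2) :
    ‖texp n (I * θ)‖ ≤ 1 + 2 * c ^ n / n.factorial := by
  have h1 := texp_err hθ hc
  have h2 : ‖texp n (I * θ)‖ ≤ ‖exp (I * θ)‖ + ‖exp (I * θ) - texp n (I * θ)‖ := by
    have := norm_sub_le (exp (I * θ)) (exp (I * θ) - texp n (I * θ))
    simpa using this
  rw [Complex.norm_exp_I_mul_ofReal] at h2
  linarith

/-! ### The model value of one term -/

/-- The weight error: `Σ_{k<n} W_k (iσ)^k = K₁·T_n(iσc) + E` with `‖E‖ ≤ n` when `|W_k − K₁c^k/k!| ≤ 1`, `|σ| ≤ 1`. -/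
theorem weights_split {n K1 : ℕ} {c σ : ℝ} {W : ℕ → ℕ} (hW : ∀ k, k < n → |(W k : ℝ) - K1 * c ^ k / k.factorial| ≤ 1)
    (hσ : |σ| ≤ 1) :
    ‖(∑ k ∈ range n, (W k : ℂ) * (I * σ) ^ k) - (K1 : ℂ) * texp n (I * ((σ * c : ℝ) : ℂ))‖ ≤ n := by
  unfold texp
  rw [Finset.mul_sum, ← Finset.sum_sub_distrib]
  have hterm : ∀ k ∈ range n, ‖(W k : ℂ) * (I * σ) ^ k - (K1 : ℂ) * ((I * ((σ * c : ℝ) : ℂ)) ^ k / (k.factorial : ℂ))‖ ≤ 1 := by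
    intro k hk
    have e : (K1 : ℂ) * ((I * ((σ * c : ℝ) : ℂ)) ^ k / (k.factorial : ℂ)) = ((K1 * c ^ k / k.factorial : ℝ) : ℂ) * (I * σ) ^ k := by
      push_cast
      rw [mul_pow, mul_pow, mul_pow]
      field_simp
    rw [e, ← sub_mul, norm_mul, norm_pow, norm_mul, Complex.norm_I, one_mul, Complex.norm_real, Real.norm_eq_abs]
    have h1 : ‖((W k : ℂ)) - ((K1 * c ^ k / k.factorial : ℝ) : ℂ)‖ ≤ 1 := by
      rw [show (W k : ℂ) = ((W k : ℝ) : ℂ) by norm_cast, ← Complex.ofReal_sub, Complex.norm_real, Real.norm_eq_abs]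
      exact hW k (Finset.mem_range.1 hk)
    have h2 : |σ| ^ k ≤ 1 := pow_le_one₀ (abs_nonneg σ) hσ
    calc ‖(W k : ℂ) - ((K1 * c ^ k / k.factorial : ℝ) : ℂ)‖ * |σ| ^ k ≤ 1 * 1 :=
        mul_le_mul h1 h2 (by positivity) (by norm_num)
      _ = 1 := by norm_num
  calc ‖∑ k ∈ range n, ((W k : ℂ) * (I * σ) ^ k - (K1 : ℂ) * ((I * ((σ * c : ℝ) : ℂ)) ^ k / (k.factorial : ℂ)))‖
      ≤ ∑ k ∈ range n, ‖(W k : ℂ) * (I * σ) ^ k - (K1 : ℂ) * ((I * ((σ * c : ℝ) : ℂ)) ^ k / (k.factorial : ℂ))‖ := norm_sum_le _ _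
    _ ≤ ∑ k ∈ range n, (1 : ℝ) := Finset.sum_le_sum hterm
    _ = n := by simp

/-- **Model value error of one term.**  With `ρ = 2c^n/n!` (`n = D+1` terms, `c ≤ (n+1)/2`) and the phasor scale `B`
(`= 2^104`): `|Re(ζ̂ Σ_k W_k (iσ)^k) − B K₁ Re(ζ e^{iσν'})| ≤ B K₁ (δ(1+ρ) + ρ + Δ') + n‖ζ̂‖`. -/
theorem term_value_err {n K1 : ℕ} {B c ν' δ Δ' σ : ℝ} {W : ℕ → ℕ} {ζ ζh : ℂ} (hB : 0 ≤ B)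
    (hW : ∀ k, k < n → |(W k : ℝ) - K1 * c ^ k / k.factorial| ≤ 1) (hc0 : 0 ≤ c) (hc : c ≤ ((n : ℝ) + 1) / 2)
    (hζ : ‖ζ‖ = 1) (hζh : ‖ζh - (B : ℂ) * ζ‖ ≤ B * δ) (hν : |c - ν'| ≤ Δ') (hσ : |σ| ≤ 1) :
    |(ζh * ∑ k ∈ range n, (W k : ℂ) * (I * σ) ^ k).re - B * K1 * (ζ * exp (I * ((σ * ν' : ℝ) : ℂ))).re| ≤
      B * K1 * (δ * (1 + 2 * c ^ n / n.factorial) + 2 * c ^ n / n.factorial + Δ') + n * ‖ζh‖ := by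
  set ρ : ℝ := 2 * c ^ n / n.factorial with hρ
  set T := texp n (I * ((σ * c : ℝ) : ℂ)) with hT
  set S := ∑ k ∈ range n, (W k : ℂ) * (I * σ) ^ k with hS
  have hσc : |σ * c| ≤ c := by rw [abs_mul, abs_of_nonneg hc0]; exact mul_le_of_le_one_left hc0 hσ
  have hE : ‖S - (K1 : ℂ) * T‖ ≤ n := weights_split hW hσ
  have hTe : ‖exp (I * ((σ * c : ℝ) : ℂ)) - T‖ ≤ ρ := texp_err hσc hc
  have hTn : ‖T‖ ≤ 1 + ρ := norm_texp_le hσc hc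
  have hee : ‖exp (I * ((σ * c : ℝ) : ℂ)) - exp (I * ((σ * ν' : ℝ) : ℂ))‖ ≤ Δ' := by
    refine (norm_expI_sub_expI _ _).trans ?_
    rw [← mul_sub, abs_mul]
    calc |σ| * |c - ν'| ≤ 1 * Δ' := mul_le_mul hσ hν (abs_nonneg _) (by norm_num)
      _ = Δ' := one_mul _
  -- decomposition
  have hdec : ζh * S - (B : ℂ) * (K1 : ℂ) * (ζ * exp (I * ((σ * ν' : ℝ) : ℂ))) =
      (K1 : ℂ) * ((ζh - (B : ℂ) * ζ) * T) + (B : ℂ) * (K1 : ℂ) * (ζ * (T - exp (I * ((σ * c : ℝ) : ℂ)))) +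
        (B : ℂ) * (K1 : ℂ) * (ζ * (exp (I * ((σ * c : ℝ) : ℂ)) - exp (I * ((σ * ν' : ℝ) : ℂ)))) + ζh * (S - (K1 : ℂ) * T) := by
    ring
  have hK : (0 : ℝ) ≤ K1 := Nat.cast_nonneg _
  have hBn : ‖(B : ℂ)‖ = B := by rw [Complex.norm_real, Real.norm_eq_abs, abs_of_nonneg hB]
  have hnorm : ‖ζh * S - (B : ℂ) * (K1 : ℂ) * (ζ * exp (I * ((σ * ν' : ℝ) : ℂ)))‖ ≤
      B * K1 * (δ * (1 + ρ) + ρ + Δ') + n * ‖ζh‖ := by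
    rw [hdec]
    refine (norm_add_le _ _).trans ?_
    refine (add_le_add (norm_add_le _ _) le_rfl).trans ?_
    refine (add_le_add (add_le_add (norm_add_le _ _) le_rfl) le_rfl).trans ?_
    have t1 : ‖(K1 : ℂ) * ((ζh - (B : ℂ) * ζ) * T)‖ ≤ K1 * (B * δ * (1 + ρ)) := by
      rw [norm_mul, norm_mul, Complex.norm_natCast]
      exact mul_le_mul_of_nonneg_left (mul_le_mul hζh hTn (norm_nonneg _) ((norm_nonneg _).trans hζh)) hK
    have t2 : ‖(B : ℂ) * (K1 : ℂ) * (ζ * (T - exp (I * ((σ * c : ℝ) : ℂ))))‖ ≤ B * K1 * ρ := by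
      rw [norm_mul, norm_mul, norm_mul, Complex.norm_natCast, hζ, one_mul, norm_sub_rev, hBn]
      exact mul_le_mul_of_nonneg_left hTe (by positivity)
    have t3 : ‖(B : ℂ) * (K1 : ℂ) * (ζ * (exp (I * ((σ * c : ℝ) : ℂ)) - exp (I * ((σ * ν' : ℝ) : ℂ))))‖ ≤ B * K1 * Δ' := by
      rw [norm_mul, norm_mul, norm_mul, Complex.norm_natCast, hζ, one_mul, hBn]
      exact mul_le_mul_of_nonneg_left hee (by positivity)
    have t4 : ‖ζh * (S - (K1 : ℂ) * T)‖ ≤ n * ‖ζh‖ := by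
      rw [norm_mul, mul_comm]; exact mul_le_mul_of_nonneg_right hE (norm_nonneg _)
    have := add_le_add (add_le_add (add_le_add t1 t2) t3) t4
    refine this.trans (le_of_eq ?_)
    ring
  have hre := Complex.abs_re_le_norm (ζh * S - (B : ℂ) * (K1 : ℂ) * (ζ * exp (I * ((σ * ν' : ℝ) : ℂ))))
  rw [Complex.sub_re] at hre
  have e2 : ((B : ℂ) * (K1 : ℂ) * (ζ * exp (I * ((σ * ν' : ℝ) : ℂ)))).re = B * K1 * (ζ * exp (I * ((σ * ν' : ℝ) : ℂ))).re := by
    rw [show (B : ℂ) * (K1 : ℂ) = ((B * K1 : ℝ) : ℂ) by push_cast; ring, Complex.re_ofReal_mul]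
  rw [e2] at hre
  exact hre.trans hnorm

end Summit.RiemannHypothesis.RiemannHypothesis.Theorems.IntegerScrew.Manifest.Fast
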